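import Summits.ResolutionOfSingularities.ResolutionOfSingularities.Theorems.SharpStrataResSepExcIsolatedCore
import Literature.AlgebraicGeometry.Resolution.ResolutionOfComponents
import Literature.AlgebraicGeometry.Resolution.BlowupsFlatBaseChange
import Literature.AlgebraicGeometry.Resolution.PrincipalizationToResolution
import Mathlib.AlgebraicGeometry.Noetherian
import HarnessLib

/-!
# Crux `SharpStrata.ResSepExc` (stmt-16829): the component calibration — the crux closes the
# perfect-field case of `IsolatedCore.IsolatedResolution` (stmt-18021) AS FILED (reduced schemes),
# and modulo the perfect-field case of `FiniteSingularModels` (stmt-18020) it is equivalent to it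

Route files: `Theses/SharpStrata.lean` (crux `ResSepExc`: separably exceptional integral varieties
over perfect fields of characteristic `p` are resolvable) and `Theses/IsolatedCore.lean` (crux
`FiniteSingularModels` = W: proper birational reduced models with finitely many non-regular points;
crux `IsolatedResolution` = K: REDUCED separated finite-type schemes over a field of characteristic
`p` with finitely many non-regular points are resolvable).

`Theorems/SharpStrataResSepExcIsolatedCore.lean` (p149609) proved `ResSepExc ⟹ K` for INTEGRAL
schemes over perfect fields (`hasResolution_of_resSepExc_of_finite_nonRegular`). K is filed for
REDUCED schemes. This file removes the gap, kernel-checked, with no new definition: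

* `finite_nonRegular_subscheme_of_mem_irreducibleComponents` — **finitely many non-regular points
  descends to the irreducible components**: if the reduced scheme `X` has finitely many irreducible
  components and finitely many non-regular points, then each irreducible component `Z`, with its
  reduced (= integral) closed-subscheme structure `(vanishingIdeal Z).subscheme`, has finitely many
  non-regular points. Proof: a regular point `x` of `X` has a domain as local ring
  (Matsumura Thm. 14.3), so it lies on ONE irreducible component
  (`eq_of_mem_irreducibleComponents_of_isDomain_stalk`); hence a regular point of `X` on `Z` lies in
  the open complement `A` of the other components, over which the closed immersion `Z ↪ X` is an
  isomorphism (`isIso_morphismRestrict_of_isClosedImmersion`, the target being reduced), so the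
  point is regular on `Z` too (`mem_regularLocus_iff_of_isIso_morphismRestrict`). So the non-regular
  points of `Z` inject into those of `X`.
* `hasResolution_of_resSepExc_of_finite_nonRegular_reduced` — **`ResSepExc` resolves every REDUCED
  separated finite-type scheme over a perfect field of characteristic `p` with finitely many
  non-regular points**: resolve each component by the integral case and glue
  (`hasResolution_of_irreducibleComponents`, Cossart–Piltant 2019, proof of Prop. 4.6, Step 1).
* `isolatedResolution_perfectField_of_resSepExc` — the same in the VERBATIM binder shape of
  stmt-18021 with `[PerfectField k]` inserted: **the crux implies the perfect-field case of K as
  filed.** Since K|perfect is thereby a consequence of the crux, and K is open from dimension `4`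
  (isolated hypersurface singularities `z^p + g(x,y,u,v) = 0` over `𝔽_p`), this is the precise sense
  in which stmt-16829 is blocked on stmt-18021.
* `resSepExc_of_isolatedCore_perfectField` — conversely **W|perfect ∧ K|perfect ⟹ `ResSepExc`**
  (model, resolve, transport down the proper birational map), the perfect-field sharpening of
  `resSepExc_of_finiteSingularModels_of_isolatedResolution` (p149609); and
  `resSepExc_iff_isolatedResolution_perfectField` — **modulo W|perfect, the crux `ResSepExc` is
  EQUIVALENT to K|perfect.**

## Sources

* V. Cossart, O. Piltant, *Resolution of singularities of arithmetical threefolds*, J. Algebra 529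
  (2019) 268–535, proof of Prop. 4.6 [arXiv:1412.0868 v1: Prop. 4.4], Step 1 (reduction to the
  irreducible components, "isomorphic above `Reg 𝒳`"). [CossartPiltant2019]
* H. Matsumura, *Commutative Ring Theory*, CUP 1986, Thm. 14.3. [Matsumura1987]
* A. Benito, O. Piltant, A. Reguera, *Small irreducible components of arc spaces in positive
  characteristic*, J. Algebra 613 (2023) = arXiv:2020, §4 and Question 6.6 (the route's `SepExc`).
  [BenitoPiltantReguera2022]
-/

noncomputable section

-- single-problem summit: the doubled namespace component `ResolutionOfSingularities` is forced
set_option linter.dupNamespace false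

open CategoryTheory AlgebraicGeometry TopologicalSpace Literature.AlgebraicGeometry.Resolution
open Summit.ResolutionOfSingularities.ResolutionOfSingularities.Theses

namespace Summit.ResolutionOfSingularities.ResolutionOfSingularities.Theorems.SharpStrata

/-! ## Finitely many non-regular points descends to the irreducible components -/

open Scheme.IdealSheafData in
/-- **Isolated singularities pass to the irreducible components.** Let `X` be a reduced scheme
with finitely many irreducible components and finitely many non-regular points, and let `Z` be an
irreducible component with its reduced (integral) closed-subscheme structure. Then `Z` has finitely
many non-regular points: a point of `Z` whose image in `X` is regular lies on no other component
(the local ring of `X` there is a domain), i.e. in the open complement `A` of the other components,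
over which `Z ↪ X` is an isomorphism, so the point is regular on `Z`; hence the non-regular points
of `Z` inject into those of `X`. [folklore] -/
theorem finite_nonRegular_subscheme_of_mem_irreducibleComponents {X : Scheme.{0}} [IsReduced X]
    (hcomp : (irreducibleComponents (X : Type)).Finite) (Z : Closeds X)
    (hZ : (Z : Set X) ∈ irreducibleComponents X)
    (hfin : {x : X | ¬ IsRegularLocalRing (X.presheaf.stalk x)}.Finite) :
    {z : (vanishingIdeal Z).subscheme |
      ¬ IsRegularLocalRing ((vanishingIdeal Z).subscheme.presheaf.stalk z)}.Finite := by
  set ι := (vanishingIdeal Z).subschemeι with hι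
  have hr : Set.range ι = (Z : Set X) := range_subschemeι_vanishingIdeal Z
  -- the union of the other components is closed; its complement `A` is an open inside `Z`
  set Others : Set (Set X) := irreducibleComponents X \ {(Z : Set X)} with hOthers
  have hOsub : Others ⊆ irreducibleComponents X := fun W hW => hW.1
  have hOfin : Others.Finite := hcomp.subset hOsub
  have hZ'c : IsClosed (⋃₀ Others) := by
    rw [Set.sUnion_eq_biUnion]
    exact hOfin.isClosed_biUnion fun W hW => isClosed_of_mem_irreducibleComponents W (hOsub hW)
  let A : X.Opens := ⟨(⋃₀ Others)ᶜ, hZ'c.isOpen_compl⟩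
  have hA : (A : Set X) ⊆ Set.range ι := by
    intro x hx
    rw [hr]
    by_contra hxZ
    refine hx ⟨irreducibleComponent x, ⟨irreducibleComponent_mem_irreducibleComponents x, ?_⟩,
      mem_irreducibleComponent⟩
    intro h
    rw [Set.mem_singleton_iff] at h
    rw [← h] at hxZ
    exact hxZ mem_irreducibleComponent
  haveI : IsIso (ι ∣_ A) := isIso_morphismRestrict_of_isClosedImmersion ι A hA
  -- the non-regular points of the component map injectively into the non-regular points of `X`
  refine (Set.Finite.preimage ι.isClosedEmbedding.injective.injOn hfin).subset ?_
  intro z hz hx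
  apply hz
  -- `ι z` is regular in `X`: its local ring is a domain, so it lies on the component `Z` only
  haveI : IsRegularLocalRing (X.presheaf.stalk (ι z)) := hx
  haveI : IsDomain (X.presheaf.stalk (ι z)) := isDomain_of_isRegularLocalRing _
  have hzA : ι z ∈ A := by
    rintro ⟨W, hW, hzW⟩
    have hzZ : ι z ∈ (Z : Set X) := hr ▸ Set.mem_range_self z
    exact hW.2 (eq_of_mem_irreducibleComponents_of_isDomain_stalk (ι z) (hOsub hW) hZ hzW hzZ)
  exact (Scheme.mem_regularLocus z).mp
    ((mem_regularLocus_iff_of_isIso_morphismRestrict ι A z hzA).mpr ‹_›)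

/-! ## The crux closes the perfect-field case of `K` as filed (reduced schemes) -/

open Scheme.IdealSheafData in
/-- **`ResSepExc` resolves reduced schemes with finitely many non-regular points over perfect
fields**: a reduced separated scheme of finite type over a perfect field of characteristic `p`
with finitely many non-regular points has a resolution of singularities under the crux — each
irreducible component (reduced structure: an integral separated finite-type `k`-scheme) again has
finitely many non-regular points (`finite_nonRegular_subscheme_of_mem_irreducibleComponents`),
so the integral case `hasResolution_of_resSepExc_of_finite_nonRegular` resolves it, and the
resolutions of the finitely many components glue (`hasResolution_of_irreducibleComponents`).
[cite: CossartPiltant2019, proof of Prop. 4.6, Step 1] -/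
theorem hasResolution_of_resSepExc_of_finite_nonRegular_reduced (hR : SharpStrata.ResSepExc)
    {p : ℕ} (hp : p.Prime) (k : Type) [Field k] [CharP k p] [PerfectField k] (X : Scheme.{0})
    (f : X ⟶ Spec (.of k)) [IsSeparated f] [LocallyOfFiniteType f] [QuasiCompact f]
    [IsReduced X] (hfin : {x : X | ¬ IsRegularLocalRing (X.presheaf.stalk x)}.Finite) :
    Scheme.HasResolution X := by
  haveI : IsLocallyNoetherian X := LocallyOfFiniteType.isLocallyNoetherian f
  haveI : CompactSpace X := QuasiCompact.compactSpace_of_compactSpace f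
  haveI : IsNoetherian X := {}
  have hcomp : (irreducibleComponents (X : Type)).Finite :=
    NoetherianSpace.finite_irreducibleComponents
  refine hasResolution_of_irreducibleComponents X hcomp fun Z hZ => ?_
  haveI : IsIntegral (vanishingIdeal Z).subscheme :=
    isIntegral_subscheme_of_mem_irreducibleComponents Z hZ
  exact hasResolution_of_resSepExc_of_finite_nonRegular hR hp k _ ((vanishingIdeal Z).subschemeι ≫ f)
    (finite_nonRegular_subscheme_of_mem_irreducibleComponents hcomp Z hZ hfin)

/-- **The crux `ResSepExc` implies the perfect-field case of `IsolatedCore.IsolatedResolution`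
(stmt-18021) in its filed binder shape** (reduced `X`, finitely many non-regular points), with
`[PerfectField k]` the only inserted hypothesis. So resolution of reduced finite-type schemes with
isolated singularities over perfect fields of characteristic `p` — open from dimension `4` — is
a necessary condition of the crux. [folklore] -/
theorem isolatedResolution_perfectField_of_resSepExc (hR : SharpStrata.ResSepExc) :
    ∀ p : ℕ, p.Prime → ∀ (k : Type) [Field k] [CharP k p] [PerfectField k] (X : Scheme.{0})
      (f : X ⟶ Spec (.of k)), IsSeparated f → LocallyOfFiniteType f → QuasiCompact f →
      IsReduced X → {x : X | ¬ IsRegularLocalRing (X.presheaf.stalk x)}.Finite →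
      Scheme.HasResolution X := by
  intro p hp k _ _ _ X f hs hl hq hred hfin
  haveI := hs; haveI := hl; haveI := hq; haveI := hred
  exact hasResolution_of_resSepExc_of_finite_nonRegular_reduced hR hp k X f hfin

/-- `IsolatedCore.IsolatedResolution` (K, all fields of characteristic `p`) trivially implies its
perfect-field case. [folklore] -/
theorem isolatedResolution_perfectField_of_isolatedResolution
    (hK : IsolatedCore.IsolatedResolution) :
    ∀ p : ℕ, p.Prime → ∀ (k : Type) [Field k] [CharP k p] [PerfectField k] (X : Scheme.{0})
      (f : X ⟶ Spec (.of k)), IsSeparated f → LocallyOfFiniteType f → QuasiCompact f →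
      IsReduced X → {x : X | ¬ IsRegularLocalRing (X.presheaf.stalk x)}.Finite →
      Scheme.HasResolution X :=
  fun p hp k _ _ _ X f hs hl hq hred hfin => hK p hp k X f hs hl hq hred hfin

/-! ## Conversely: `W|perfect ∧ K|perfect ⟹ ResSepExc`; modulo `W|perfect` the crux is `K|perfect` -/

/-- **The perfect-field cases of the two `IsolatedCore` cruxes give `ResSepExc`** (the hypothesis
`SepExc X` idle): take the reduced model `π : X' → X` with finitely many non-regular points
(W over the perfect field `k`), resolve `X'` (K over `k`; `π ≫ f` is separated, locally of finite
type and quasi-compact since `π` is proper), and transport the resolution down the proper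
birational `π` (`ComponentGluing.Scheme.HasResolution.of_isBirational`). [folklore] -/
theorem resSepExc_of_isolatedCore_perfectField
    (hW : ∀ p : ℕ, p.Prime → ∀ (k : Type) [Field k] [CharP k p] [PerfectField k] (X : Scheme.{0})
      (f : X ⟶ Spec (.of k)), IsSeparated f → LocallyOfFiniteType f → QuasiCompact f →
      IsReduced X → ∃ (X' : Scheme.{0}) (π : X' ⟶ X), IsProper π ∧ IsBirational π ∧
        IsReduced X' ∧ {x : X' | ¬ IsRegularLocalRing (X'.presheaf.stalk x)}.Finite)
    (hK : ∀ p : ℕ, p.Prime → ∀ (k : Type) [Field k] [CharP k p] [PerfectField k] (X : Scheme.{0})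
      (f : X ⟶ Spec (.of k)), IsSeparated f → LocallyOfFiniteType f → QuasiCompact f →
      IsReduced X → {x : X | ¬ IsRegularLocalRing (X.presheaf.stalk x)}.Finite →
      Scheme.HasResolution X) :
    SharpStrata.ResSepExc := by
  intro p hp k _ _ _ X _ f hs hl hq _
  haveI := hs; haveI := hl; haveI := hq
  obtain ⟨X', π, hπ, hb, hred, hfin⟩ := hW p hp k X f hs hl hq inferInstance
  haveI := hπ; haveI := hred
  refine ComponentGluing.Scheme.HasResolution.of_isBirational π hb ?_
  exact hK p hp k X' (π ≫ f) inferInstance inferInstance inferInstance hred hfin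

/-- **Modulo the perfect-field case of `FiniteSingularModels` (stmt-18020), the crux `ResSepExc`
(stmt-16829) is EQUIVALENT to the perfect-field case of `IsolatedResolution` (stmt-18021).**
[folklore] -/
theorem resSepExc_iff_isolatedResolution_perfectField
    (hW : ∀ p : ℕ, p.Prime → ∀ (k : Type) [Field k] [CharP k p] [PerfectField k] (X : Scheme.{0})
      (f : X ⟶ Spec (.of k)), IsSeparated f → LocallyOfFiniteType f → QuasiCompact f →
      IsReduced X → ∃ (X' : Scheme.{0}) (π : X' ⟶ X), IsProper π ∧ IsBirational π ∧
        IsReduced X' ∧ {x : X' | ¬ IsRegularLocalRing (X'.presheaf.stalk x)}.Finite) :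
    SharpStrata.ResSepExc ↔
      ∀ p : ℕ, p.Prime → ∀ (k : Type) [Field k] [CharP k p] [PerfectField k] (X : Scheme.{0})
        (f : X ⟶ Spec (.of k)), IsSeparated f → LocallyOfFiniteType f → QuasiCompact f →
        IsReduced X → {x : X | ¬ IsRegularLocalRing (X.presheaf.stalk x)}.Finite →
        Scheme.HasResolution X :=
  ⟨isolatedResolution_perfectField_of_resSepExc, resSepExc_of_isolatedCore_perfectField hW⟩

/-- **`W ∧ ResSepExc ⟹ K|perfect` and `W ⟹ (ResSepExc ↔ K|perfect)`**, with W the full crux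
`IsolatedCore.FiniteSingularModels` (stmt-18020). [folklore] -/
theorem resSepExc_iff_isolatedResolution_perfectField_of_finiteSingularModels
    (hW : IsolatedCore.FiniteSingularModels) :
    SharpStrata.ResSepExc ↔
      ∀ p : ℕ, p.Prime → ∀ (k : Type) [Field k] [CharP k p] [PerfectField k] (X : Scheme.{0})
        (f : X ⟶ Spec (.of k)), IsSeparated f → LocallyOfFiniteType f → QuasiCompact f →
        IsReduced X → {x : X | ¬ IsRegularLocalRing (X.presheaf.stalk x)}.Finite →
        Scheme.HasResolution X :=
  resSepExc_iff_isolatedResolution_perfectField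
    fun p hp k _ _ _ X f hs hl hq hred => hW p hp k X f hs hl hq hred

end Summit.ResolutionOfSingularities.ResolutionOfSingularities.Theorems.SharpStrata

end
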